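import Mathlib
import Summits.Ventures.PercRepro2.LocRows
import Summits.Ventures.PercRepro2.SwRow
import Summits.Ventures.PercRepro2.SwOut
import Summits.Ventures.PercRepro2.SwAllRow
import Summits.Ventures.PercRepro2.SwOutAll
import Summits.Ventures.PercRepro2.SwOutArmFlip
import Summits.Ventures.PercRepro2.SwOutArmThm
import Summits.Ventures.PercRepro2.SwOutJunction
import Summits.Ventures.PercRepro2.SwOutJunctionRegion
import Summits.Ventures.PercRepro2.SwOutCoreDefs
import Summits.Ventures.PercRepro2.SwOutCoreKey
import Summits.Ventures.PercRepro2.SwOutJunctionH1Defs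
import Summits.Ventures.PercRepro2.SwOutJunctionH1Arms
import Summits.Ventures.PercRepro2.SwOutJunctionH1Cover
import Summits.Ventures.PercRepro2.SwOutJunctionH1Inside
import Summits.Ventures.PercRepro2.SwOutJunctionH1Base
import Summits.Ventures.PercRepro2.SwOutEdgeDefs

/-!
# The canonical e-core base of a core-kind point (blind cell PercRepro2, night-4 g16,
2026-08-26; proofs/NIGHT4-G15.md §4, proofs/NIGHT4-G16.md §2)

Theorem A⁺: the junction `u` is ADJACENT to `h`.  For a `Q`-point `ζ` of the class of the CORE
KIND (`u` in the hull of `h` — automatic here — and the hull of `u` inside `U`), the canonical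
e-core base `coreBaseOfE ζ` is the canonical base `coreBaseOf ζ` of `SwOutCoreKey` (the blue arms
flipped to red) with the h–u edges RED.  It is an e-core base on the concrete arms `armsC ζ`
(`coreBaseE_of_coreKind`: the proof of `coreBase_of_coreKind` with the h–u edges handled in
`h_edges` / `u_edges` / `h_red` / `u_red` / `bdry_blue`; the arms never contain `h` or `u`, so the
inside colourings of the arms are unchanged), and, when there is a SINGLE h–u edge, `ζ` is the cube
point `omegaOfE ζ` of that base — its red arms, and the colour of the h–u edge
(`coreRealE_coreBaseOfE`).  (A class of parallel h–u edges of mixed colours is not a point of the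
e-cube; Theorem A⁺ carries the single-edge hypothesis.)
-/

namespace Summit.Ventures.PercRepro2

namespace LocRows

open Hull

variable {V : Type*} {E : Type*} [Fintype E] [DecidableEq E]

open scoped Classical

variable {ends : E → Sym2 V} {U : Set V} {ξ : Config E} {l h o u : V}

variable (ends) in
/-- The canonical e-core base: the canonical base with the h–u edges red. -/
noncomputable def coreBaseOfE (ζ : Config E) (h u : V) : Config E :=
  fun e => if ends e = s(h, u) then true else coreBaseOf ends ζ h u e

omit [Fintype E] [DecidableEq E] in
/-- The canonical e-core base on an h–u edge: red. -/
lemma coreBaseOfE_apply_hu {ζ : Config E} {e : E} (he : ends e = s(h, u)) :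
    coreBaseOfE ends ζ h u e = true := by
  simp only [coreBaseOfE, if_pos he]

omit [Fintype E] [DecidableEq E] in
/-- The canonical e-core base on any other edge: the canonical base. -/
lemma coreBaseOfE_apply_of_not_hu {ζ : Config E} {e : E} (he : ends e ≠ s(h, u)) :
    coreBaseOfE ends ζ h u e = coreBaseOf ends ζ h u e := by
  simp only [coreBaseOfE, if_neg he]

omit [Fintype E] [DecidableEq E] in
/-- An edge at `h` whose other end is `u` is an h–u edge, and conversely. -/
lemma eq_u_of_ends_eq_hu (hhu : h ≠ u) {e : E} {x : V} (hxe : ends e = s(h, x))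
    (he : ends e = s(h, u)) : x = u := by
  rw [hxe, Sym2.eq_iff] at he
  rcases he with ⟨_, h2⟩ | ⟨h1, _⟩
  · exact h2
  · exact absurd h1 hhu

omit [Fintype E] [DecidableEq E] in
/-- An edge at `u` whose other end is `h` is an h–u edge, and conversely. -/
lemma eq_h_of_ends_eq_hu (hhu : h ≠ u) {e : E} {x : V} (hxe : ends e = s(u, x))
    (he : ends e = s(h, u)) : x = h := by
  rw [hxe, Sym2.eq_iff] at he
  rcases he with ⟨h1, _⟩ | ⟨_, h2⟩
  · exact absurd h1.symm hhu
  · exact h2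

omit [Fintype E] [DecidableEq E] in
/-- No h–u edge lies inside `P ∪ {v}` when `P` avoids `h` and `u` (`v = h` or `v = u`). -/
lemma not_hu_of_within_of_notMem (hhu : h ≠ u) {P : Set V} (hhP : h ∉ P) (huP : u ∉ P) {v : V}
    (hv : v = h ∨ v = u) {e : E} (he : e ∈ within ends (P ∪ {v})) : ends e ≠ s(h, u) := by
  intro hhu'
  obtain ⟨x, hx, y, hy, hxy⟩ := he
  rw [hhu', Sym2.eq_iff] at hxy
  have key : ∀ z, z ∈ P ∪ {v} → z = h ∨ z = u → z = v := by
    rintro z (hz | hz) (rfl | rfl)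
    · exact absurd hz hhP
    · exact absurd hz huP
    · exact hz
    · exact hz
  rcases hxy with ⟨hxh, hyu⟩ | ⟨hxu, hyh⟩
  · exact hhu (hxh.trans (((key x hx (Or.inl hxh.symm)).trans
      (key y hy (Or.inr hyu.symm)).symm).trans hyu.symm))
  · exact hhu (hxu.trans (((key y hy (Or.inl hxu.symm)).trans
      (key x hx (Or.inr hyh.symm)).symm).trans hyh.symm))

omit [Fintype E] [DecidableEq E] in
/-- The inside colouring of `P ∪ {v}` (`P` avoiding `h`, `u`) is the same for the canonical
e-core base and the canonical base. -/
lemma insideConfig_coreBaseOfE_eq (hhu : h ≠ u) {ζ : Config E} {P : Set V} (hhP : h ∉ P)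
    (huP : u ∉ P) {v : V} (hv : v = h ∨ v = u) :
    insideConfig ends (P ∪ {v}) (coreBaseOfE ends ζ h u) =
      insideConfig ends (P ∪ {v}) (coreBaseOf ends ζ h u) := by
  funext e
  simp only [insideConfig]
  by_cases he : e ∈ within ends (P ∪ {v})
  · rw [coreBaseOfE_apply_of_not_hu (not_hu_of_within_of_notMem hhu hhP huP hv he)]
  · rw [decide_eq_false he]
    simp

/-- **The canonical e-core base of a core-kind `Q`-point is an e-core base on its arms**
(`u` adjacent to `h`). -/
theorem coreBaseE_of_coreKind (hl : l ∉ U) (hhu : h ≠ u) (hloop_h : ∀ e, ends e ≠ s(h, h))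
    (hloop_u : ∀ e, ends e ≠ s(u, u)) (hadj : ∃ e, ends e = s(h, u))
    (hout : ∀ x ∈ U, x ≠ h → x ≠ o → x ≠ u →
      (∃ e y, ends e = s(x, y) ∧ y ∉ U) ∨ (∀ e, x ∉ ends e))
    (hH1 : H1 ends U h u) {ζ : Config E} (hζ : ζ ∈ swOutSide ends l h o U ξ)
    (hk : CoreKind ends U h u ζ) :
    CoreBaseE ends (coreBaseOfE ends ζ h u) h u (extHull ends ζ h u)
      (fun P : armsC ends h u ζ => P.1) (fun P => pureC ends h P.1) := by
  have hdisj : ∀ x, x ∈ redExt ends h u ζ → x ∈ blueExt ends ζ h u → False :=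
    fun x hxR hxB => redExt_disjoint_blueExt hl hout hζ hk x hxR hxB
  have hnoRB : ∀ e x y, ends e = s(x, y) → x ∈ redExt ends h u ζ → y ∈ blueExt ends ζ h u →
      False := fun e x y hxy hx hy => no_edge_redExt_blueExt hdisj hxy hx hy
  have hHU : extHull ends ζ h u ⊆ U := by
    intro x hx
    rcases hx with hx | hx
    · exact (mem_outClass.1 (mem_swOutSide.1 hζ).2).2 hx
    · exact hk.2 hx
  -- the blue colouring's sides are the sides exchanged
  have hdisj' : ∀ x, x ∈ redExt ends h u (blue ζ) → x ∈ blueExt ends (blue ζ) h u → False := by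
    intro x hxR hxB
    rw [redExt_blue] at hxR
    rw [blueExt_blue] at hxB
    exact hdisj x hxB hxR
  have hHU' : extHull ends (blue ζ) h u ⊆ U := by rw [extHull_blue]; exact hHU
  -- the arms avoid `h` and `u`
  have harmP : ∀ P : armsC ends h u ζ, h ∉ P.1 ∧ u ∉ P.1 := fun P =>
    ⟨fun hh => (armsC_subset P.2 h hh).2.1 rfl, fun hu => (armsC_subset P.2 u hu).2.2 rfl⟩
  exact
  { hne := hhu
    h_mem := Or.inl (Or.inl (mem_cluster_self _ _ _))
    u_mem := Or.inr (Or.inl (mem_cluster_self _ _ _))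
    hu_exists := hadj
    bdry_blue := by
      intro e x y hxy hxH hyH
      by_cases hhu' : ends e = s(h, u)
      · exfalso
        rw [hxy, Sym2.eq_iff] at hhu'
        rcases hhu' with ⟨_, rfl⟩ | ⟨_, rfl⟩
        · exact hyH (Or.inr (Or.inl (mem_cluster_self _ _ _)))
        · exact hyH (Or.inl (Or.inl (mem_cluster_self _ _ _)))
      rw [coreBaseOfE_apply_of_not_hu hhu']
      have hyB : y ∉ blueExt ends ζ h u := fun h' => hyH (blueExt_subset_extHull h')
      rw [extHull_eq] at hxH
      rcases hxH with ((rfl | rfl) | hxR) | hxB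
      · exfalso
        cases he : ζ e with
        | true => exact hyH (Or.inl (Or.inl (mem_cluster_of_edge (mem_cluster_self _ _ _) he hxy)))
        | false =>
          have he' : blue ζ e = true := by rw [blue_eq_true_iff]; exact he
          exact hyH (Or.inl (Or.inr (mem_cluster_of_edge (mem_cluster_self _ _ _) he' hxy)))
      · exfalso
        cases he : ζ e with
        | true => exact hyH (Or.inr (Or.inl (mem_cluster_of_edge (mem_cluster_self _ _ _) he hxy)))
        | false =>
          have he' : blue ζ e = true := by rw [blue_eq_true_iff]; exact he
          exact hyH (Or.inr (Or.inr (mem_cluster_of_edge (mem_cluster_self _ _ _) he' hxy)))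
      · rw [coreBaseOf_apply_of_notMem hxy (fun h' => hdisj x hxR h') hyB]
        cases he : ζ e with
        | true => exact absurd (mem_extHull_of_red_of_mem_redExt hxy hxR he) hyH
        | false => rfl
      · rw [coreBaseOf_apply_of_mem hxy hxB]
        cases he : ζ e with
        | true => rfl
        | false =>
          exfalso
          have hxR' : x ∈ redExt ends h u (blue ζ) := by rw [redExt_blue]; exact hxB
          have he' : blue ζ e = true := by rw [blue_eq_true_iff]; exact he
          have := mem_extHull_of_red_of_mem_redExt hxy hxR' he'
          rw [extHull_blue] at this
          exact hyH this
    arm_sub := fun P x hx => armsC_subset P.2 x hx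
    arm_nonempty := fun P => armsC_nonempty P.2
    arm_disj := fun P P' hne x hx => armsC_disjoint P.2 P'.2 (fun h' => hne (Subtype.ext h')) x hx
    arm_cover := by
      intro x hxH hxh hxu
      obtain ⟨P, hP, hxP⟩ := exists_armsC_of_mem hhu hxH hxh hxu
      exact ⟨⟨P, hP⟩, hxP⟩
    no_cross := fun P P' hne e x y hxy hx hy =>
      armsC_no_cross P.2 P'.2 (fun h' => hne (Subtype.ext h')) hxy hx hy
    h_edges := by
      intro e x hxe
      by_cases hxu : x = u
      · exact Or.inl hxu
      right
      have hxh : x ≠ h := fun h' => hloop_h e (by rw [hxe, h'])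
      have hxH : x ∈ extHull ends ζ h u := by
        cases he : ζ e with
        | true => exact Or.inl (Or.inl (mem_cluster_of_edge (mem_cluster_self _ _ _) he hxe))
        | false =>
          have he' : blue ζ e = true := by rw [blue_eq_true_iff]; exact he
          exact Or.inl (Or.inr (mem_cluster_of_edge (mem_cluster_self _ _ _) he' hxe))
      obtain ⟨P, hP, hxP⟩ := exists_armsC_of_mem hhu hxH hxh hxu
      exact ⟨⟨P, hP⟩, hxP⟩
    h_red := by
      intro e x hxe
      by_cases hxu : x = u
      · exact coreBaseOfE_apply_hu (by rw [hxe, hxu])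
      rw [coreBaseOfE_apply_of_not_hu (fun h' => hxu (eq_u_of_ends_eq_hu hhu hxe h'))]
      have hxh : x ≠ h := fun h' => hloop_h e (by rw [hxe, h'])
      cases he : ζ e with
      | true =>
        have hxR : x ∈ redExt ends h u ζ := by
          rw [mem_redExt_iff]
          exact ⟨Or.inl (mem_cluster_of_edge (mem_cluster_self _ _ _) he hxe), hxh, hxu⟩
        rw [coreBaseOf_apply_of_notMem hxe h_notMem_blueExt (fun h' => hdisj x hxR h'), he]
      | false =>
        have he' : blue ζ e = true := by rw [blue_eq_true_iff]; exact he
        have hxB : x ∈ blueExt ends ζ h u := by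
          rw [mem_blueExt_iff]
          exact ⟨Or.inl (mem_cluster_of_edge (mem_cluster_self _ _ _) he' hxe), hxh, hxu⟩
        rw [coreBaseOf_apply_of_mem (ends_swap hxe) hxB, he]
        rfl
    u_edges := by
      intro e x hxe
      by_cases hxh : x = h
      · exact Or.inl hxh
      right
      have hxu : x ≠ u := fun h' => hloop_u e (by rw [hxe, h'])
      have hxH : x ∈ extHull ends ζ h u := by
        cases he : ζ e with
        | true => exact Or.inr (Or.inl (mem_cluster_of_edge (mem_cluster_self _ _ _) he hxe))
        | false =>
          have he' : blue ζ e = true := by rw [blue_eq_true_iff]; exact he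
          exact Or.inr (Or.inr (mem_cluster_of_edge (mem_cluster_self _ _ _) he' hxe))
      obtain ⟨P, hP, hxP⟩ := exists_armsC_of_mem hhu hxH hxh hxu
      exact ⟨⟨P, hP⟩, hxP⟩
    u_red := by
      intro e x hxe
      by_cases hxh : x = h
      · exact coreBaseOfE_apply_hu (by rw [hxe, hxh, Sym2.eq_swap])
      rw [coreBaseOfE_apply_of_not_hu (fun h' => hxh (eq_h_of_ends_eq_hu hhu hxe h'))]
      have hxu : x ≠ u := fun h' => hloop_u e (by rw [hxe, h'])
      cases he : ζ e with
      | true =>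
        have hxR : x ∈ redExt ends h u ζ := by
          rw [mem_redExt_iff]
          exact ⟨Or.inr (mem_cluster_of_edge (mem_cluster_self _ _ _) he hxe), hxh, hxu⟩
        rw [coreBaseOf_apply_of_notMem hxe u_notMem_blueExt (fun h' => hdisj x hxR h'), he]
      | false =>
        have he' : blue ζ e = true := by rw [blue_eq_true_iff]; exact he
        have hxB : x ∈ blueExt ends ζ h u := by
          rw [mem_blueExt_iff]
          exact ⟨Or.inr (mem_cluster_of_edge (mem_cluster_self _ _ _) he' hxe), hxh, hxu⟩
        rw [coreBaseOf_apply_of_mem (ends_swap hxe) hxB, he]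
        rfl
    harm_conn := by
      intro P hnp x hx
      have hy : ∃ e y, ends e = s(h, y) ∧ y ∈ P.1 := by
        by_contra hno
        exact hnp fun e y hey hyP => hno ⟨e, y, hey, hyP⟩
      rw [insideConfig_coreBaseOfE_eq hhu (harmP P).1 (harmP P).2 (Or.inl rfl)]
      rcases armsC_subset_side hnoRB P.2 with hPR | hPB
      · rw [insideConfig_coreBaseOf_of_subset_red hPR (Or.inl rfl) hdisj]
        exact harm_conn_red hH1 hHU hdisj P.2 hPR hy x hx
      · rw [insideConfig_coreBaseOf_of_subset_blue hPB hloop_h]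
        have hP' : P.1 ∈ armsC ends h u (blue ζ) := by rw [armsC_blue]; exact P.2
        have hPR' : P.1 ⊆ redExt ends h u (blue ζ) := by rw [redExt_blue]; exact hPB
        exact harm_conn_red hH1 hHU' hdisj' hP' hPR' hy x hx
    pure_conn := by
      intro P hp x hx
      rw [insideConfig_coreBaseOfE_eq hhu (harmP P).1 (harmP P).2 (Or.inr rfl)]
      rcases armsC_subset_side hnoRB P.2 with hPR | hPB
      · rw [insideConfig_coreBaseOf_of_subset_red hPR (Or.inr rfl) hdisj]
        exact pure_conn_red P.2 hPR hp x hx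
      · rw [insideConfig_coreBaseOf_of_subset_blue hPB hloop_u]
        have hP' : P.1 ∈ armsC ends h u (blue ζ) := by rw [armsC_blue]; exact P.2
        have hPR' : P.1 ⊆ redExt ends h u (blue ζ) := by rw [redExt_blue]; exact hPB
        exact pure_conn_red hP' hPR' hp x hx
    pure_no_h := fun P hp e x hxe => hp e x hxe }

/-- The e-cube point of `ζ`: the arms on its red side, and the colour of the h–u edges. -/
noncomputable def omegaOfE (ends : E → Sym2 V) (h u : V) (ζ : Config E) :
    Config (Option (armsC ends h u ζ)) :=
  fun j => match j with
    | none => decide (∀ e, ends e = s(h, u) → ζ e = true)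
    | some P => omegaOf ends h u ζ P

omit [DecidableEq E] in
/-- The arm coordinates of `omegaOfE` are `omegaOf`. -/
lemma omegaOfE_comp_some (ζ : Config E) : omegaOfE ends h u ζ ∘ some = omegaOf ends h u ζ := by
  funext P; rfl

omit [DecidableEq E] in
/-- The e-coordinate of `omegaOfE`. -/
lemma omegaOfE_none (ζ : Config E) :
    omegaOfE ends h u ζ none = decide (∀ e, ends e = s(h, u) → ζ e = true) := rfl

/-- **A core-kind point is the e-cube point of its canonical e-core base** given by its red arms
and the colour of its (single) h–u edge. -/
theorem coreRealE_coreBaseOfE (hl : l ∉ U) (hhu : h ≠ u)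
    (hhu1 : ∀ e e', ends e = s(h, u) → ends e' = s(h, u) → e = e')
    (hout : ∀ x ∈ U, x ≠ h → x ≠ o → x ≠ u →
      (∃ e y, ends e = s(x, y) ∧ y ∉ U) ∨ (∀ e, x ∉ ends e))
    {ζ : Config E} (hζ : ζ ∈ swOutSide ends l h o U ξ) (hk : CoreKind ends U h u ζ) :
    coreRealE ends (fun P : armsC ends h u ζ => P.1) h u (coreBaseOfE ends ζ h u)
      (omegaOfE ends h u ζ) = ζ := by
  have hcore := coreReal_coreBaseOf hl hhu hout hζ hk
  funext e
  by_cases hhu' : ends e = s(h, u)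
  · have hn : omegaOfE ends h u ζ none = decide (∀ e, ends e = s(h, u) → ζ e = true) := rfl
    simp only [coreRealE, if_pos hhu', coreBaseOfE_apply_hu hhu', hn]
    by_cases hall : ∀ e', ends e' = s(h, u) → ζ e' = true
    · rw [if_pos (decide_eq_true hall)]
      exact (hall e hhu').symm
    · rw [if_neg (fun hd => hall (decide_eq_true_iff.1 hd))]
      obtain ⟨e', he'⟩ := not_forall.1 hall
      obtain ⟨hee', hζe'⟩ := Classical.not_imp.1 he'
      have hee : e' = e := hhu1 e' e hee' hhu'
      subst hee
      simp only [Bool.not_eq_true] at hζe'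
      rw [hζe']
      rfl
  · simp only [coreRealE, if_neg hhu', omegaOfE_comp_some]
    have key : coreReal ends (fun P : armsC ends h u ζ => P.1) (coreBaseOfE ends ζ h u)
        (omegaOf ends h u ζ) e =
        coreReal ends (fun P : armsC ends h u ζ => P.1) (coreBaseOf ends ζ h u)
          (omegaOf ends h u ζ) e := by
      unfold coreReal Hull.flip
      rw [coreBaseOfE_apply_of_not_hu hhu']
    rw [key]
    exact congrFun hcore e

end LocRows

end Summit.Ventures.PercRepro2
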